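import Summits.QuantumFields.BalabanUV.T4Continuum.Support.B13Carriers
import Summits.QuantumFields.BalabanUV.T4Continuum.Support.ClusterRepOfDomains
import Literature.MathematicalPhysics.QuantumFieldTheory.Balaban1983to89.TreeLengthTorusGeometry

/-!
# NE5 ∕ node U3, row O1-a follower — `B13DomainGeometry`: route P2's printed-letters polymer geometry
# `ClusterRepOfDomains.DomainGeometry` INSTANTIATED on the two-run carriers of record `B13Carriers.TwoRuns.carriers`, and the five
# combinatorial hypotheses of P2's END face (`hloc`, `hreach`, `h126`, `hvol`, `h227` of
# `ClusterRepDecay.ne5_above_max_of_domainGeometry_linear`) DISCHARGED for it from the tree's torus geometry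
# `TreeLengthTorusGeometry.tgeometry` (every scale on its own torus)

Cell `pub-balaban`, T⁴ sub-cell, NE5 formalisation swarm seat `b2b-balaban-t4-ne5-formalise-leaf-05` (holder of row O1-a CARRIERS;
instance of record = `Support/B13Carriers.lean` p207668, ADOPTED by the holder, journal l.5870; this is the P2 supplier row
«`DomainGeometry b13Carriers`» OFFERED in the journal l.5413 (1) and taken by this seat, l.5580 ∕ l.5870 (3)(ii)).  Summits-side NEW
WORK under the LEAN PLACEMENT RULE: finite combinatorics over the carriers' index types — NO analytic object of Bałaban's construction
occurs, no estimate of the manuscripts is used or asserted; nothing of `B13Carriers` is edited (imported BY NAME).  HONEST FRAMING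
(T4-DAG p. 1): rung (B)+1 on a FIXED finite torus T⁴ — NOT infinite volume, NOT a mass gap, NOT the Clay problem; NE5 NOT PROVED (this
file supplies L01's GEOMETRY for route P2 and P2's R-KP ∕ R-decay COMBINATORIAL leaves on Bałaban's carriers; the activity families,
W1 ∕ W3, the term model and the numerics stay displayed); spine 0∕9.  HONEST DEPENDENCY (cell line, verbatim): continuum YM on T⁴ ⇐
BetaPertH ∧ nine spine estimates (0/9 proved); BetaPertH ⇐ (D1) ∧ (D4) ∧ CAP+tail; G-an2-4 gates asym, D1 and NE2/3/4.

WHAT IS PROVED (kernel-checked, Mathlib + the imported tree modules only), for every datum `R : B13Carriers.TwoRuns G`.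
* §1 the all-scales cube type `Cube R := Σ j : ℕ, TPt 4 (R.cubesPerDir j)` (a cube of `π_j` tagged by its scale), the embeddings
  `embC R j` ∕ `embD R j` of one scale's cubes ∕ domains (`R.domAt j = univ.map (embD R j)`), the tagged FOOTPRINT
  `foot X = X.2.1.map (embC R X.1)`, and the `DecidableEq` instance of `R.carriers.Dom` (the `def` `TwoRuns.carriers` is not reducible).
* §2 the TOUCHING relation of (2.11) on tagged cube families — a common cube, or two cubes OF ONE SCALE with a common torus wall
  (`CAdj`, stated WITHOUT casts between the fibres `TPt 4 (R.cubesPerDir j)`; on a fibre it IS `TreeLengthTorus.TAdj`, `cAdj_mk_iff`) —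
  decidable, symmetric, containing overlap; on the footprints of two domains of one scale it IS the tree's
  `TreeLengthTorusGeometry.TTouch` (`touch_foot_iff`); touching footprints have equal scales (`fst_eq_of_touch_foot`).
* §3 **`domainGeometry R : DomainGeometry R.carriers (Cube R)`** — route P2's L01 geometry for Bałaban's carriers (so
  `DomainGeometry.clusterRep`, `represents_re` apply BY NAME); the reach `reach X` = the tree's `treach`, tagged.
* §4 THE FIVE HYPOTHESES OF P2's END, DISCHARGED on these carriers with the tree's d = 4 constants (`tgeometry_consts_four`: ν = 9,
  κ₀ = κ₀(64, 8) = 64·log 162, K₀ = K₀(64, 8), c₁ = 64, c = 5): `loc` (touching ⇒ a footprint cube in the reach), `reach_le`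
  (#reach ≤ 9·#cubes), `ineq126_domAt` ((1.26)-shape on every 𝐃_k), `volBound_domAt` ((2.30)-shape), `ineq227_dom` ((2.27) with the
  printed 5) — each a TRANSFER along `embD` ∕ `embC` of the corresponding field of `tgeometry 4 N` (unit pv22's torus theorems), no new
  geometry; bundled as `p2_geometry_hypotheses`.
PRINTED TYPES (locators only): [Balaban1987RG1] p. 257 (π_j, 𝐃_j, d_j; the per-cube sum `Σ_{X∈𝐃_j, X⊃□} E₀exp(−κd_j(X)) ≤ E₀O(1)`
as the middle step of (0.26)); [Balaban1988RG2Cluster] (1.26) p. 8 (the displayed inequality `Σ_{X∈𝐃_j, X⊃□′} exp(−κd_j(X)) ≦ O(1)`),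
(2.11) p. 14 (ζ), (2.27), (2.30) p. 18.  0 sorry; axioms ⊆ {propext, Classical.choice, Quot.sound}.

v1.1 (DOCFIX, docstring-only; every declaration byte-identical to v1 p208264): the (1.26) locator of `ineq126_domAt` and of the line
above is corrected from «[Balaban1987RG1] (1.26) p.257» to «[Balaban1988RG2Cluster] (1.26) p.8» — the display NUMBERED (1.26) is [II]'s
(CMP 116, p. 8); on [I] p. 257 the same per-cube sum appears unnumbered inside (0.26) (XREAD C-ne5leaf07, `CLAIMS.log` l.6315, DOCFIX 1 LOW;
re-read on the page renders by the v1.1 author).  No statement, proof or constant changed.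
-/

noncomputable section

namespace Summit.QuantumFields.BalabanUV.T4Continuum.B13DomainGeometry

open Literature.MathematicalPhysics.QuantumFieldTheory.Balaban1983to89
open Literature.MathematicalPhysics.QuantumFieldTheory.Balaban1983to89.T4OutputRate (Carriers)
open Literature.MathematicalPhysics.QuantumFieldTheory.Balaban1983to89.TreeLengthTorus
  (TPt TAdj TDom torusTreeLen tsys)
open Literature.MathematicalPhysics.QuantumFieldTheory.Balaban1983to89.TreeLengthTorusGeometry
  (TTouch treach mem_treach tloc_of_touch card_treach_le ineq227_tcubes tgeometry)
open Literature.MathematicalPhysics.QuantumFieldTheory.Balaban1983to89.B13FamilySum (Ineq126 VolBound Ineq227 coveringFamilies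
  mem_coveringFamilies)
open Summit.QuantumFields.BalabanUV.T4Continuum.B13Carriers (TwoRuns)
open Summit.QuantumFields.BalabanUV.T4Continuum.ClusterRepOfDomains (DomainGeometry)

variable {G : Type} [GaugeGroup G] (R : TwoRuns G)

/-! ## §1 Tagged cubes, embeddings of one scale, footprints, the catalogue `domAt` -/

/-- THE ALL-SCALES CUBE TYPE: a scale tag `j` and a cube of `π_j` ([Balaban1987RG1] p. 257) — one `Cube` type for every creation step,
as `ClusterRepOfDomains.DomainGeometry` and `CubeChart` require. [cite: Balaban1987RG1, p.257 (localization domains)] -/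
abbrev Cube : Type := Σ j : ℕ, TPt 4 (R.cubesPerDir j)

/-- The embedding of the cubes of `π_j` into the tagged cubes (`a ↦ ⟨j, a⟩`). [folklore] -/
def embC (j : ℕ) : TPt 4 (R.cubesPerDir j) ↪ Cube R := Function.Embedding.sigmaMk (β := fun i : ℕ => TPt 4 (R.cubesPerDir i)) j

/-- The embedding of 𝐃_j into the carriers' domain index (`Y ↦ ⟨j, Y⟩` = `R.mkDom j Y`). [folklore] -/
def embD (j : ℕ) : TDom 4 (R.cubesPerDir j) ↪ R.carriers.Dom :=
  Function.Embedding.sigmaMk (β := fun i : ℕ => TDom 4 (R.cubesPerDir i)) j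

/-- [folklore] -/
@[simp] theorem embC_apply (j : ℕ) (a : TPt 4 (R.cubesPerDir j)) : embC R j a = ⟨j, a⟩ := rfl

/-- `embD R j Y` is `R.mkDom j Y` (definitional). [folklore] -/
theorem embD_eq_mkDom (j : ℕ) (Y : TDom 4 (R.cubesPerDir j)) : embD R j Y = R.mkDom j Y := rfl

/-- The scale of an embedded domain (definitional). [folklore] -/
@[simp] theorem scale_embD (j : ℕ) (Y : TDom 4 (R.cubesPerDir j)) : R.carriers.scale (embD R j Y) = j := rfl

/-- The first projection of an embedded domain (definitional). [folklore] -/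
@[simp] theorem fst_embD (j : ℕ) (Y : TDom 4 (R.cubesPerDir j)) : (embD R j Y).1 = j := rfl

/-- The cube family of an embedded domain (definitional). [folklore] -/
@[simp] theorem snd_embD (j : ℕ) (Y : TDom 4 (R.cubesPerDir j)) : (embD R j Y).2 = Y := rfl

/-- The decay length of the carriers on an embedded domain is the torus tree length (definitional). [folklore] -/
@[simp] theorem d_embD (j : ℕ) (Y : TDom 4 (R.cubesPerDir j)) : R.carriers.d (embD R j Y) = torusTreeLen Y.1 := rfl

/-- Every domain index is an embedded domain of its own scale (Σ-eta). [folklore] -/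
theorem exists_eq_embD (X : R.carriers.Dom) : ∃ (j : ℕ) (Y : TDom 4 (R.cubesPerDir j)), X = embD R j Y := ⟨X.1, X.2, rfl⟩

/-- The fibre 𝐃_j of the carriers is 𝐃_j embedded (definitional re-reading of `TwoRuns.domAt`). [folklore] -/
theorem domAt_eq_map (j : ℕ) : R.domAt j = Finset.univ.map (embD R j) := rfl

/-- Decidable equality of the carriers' domain index (instance keyed on `R.carriers.Dom`, which `TwoRuns.instDecidableEqDom` — keyed on
`R.Dom` — does not serve through the non-reducible `def carriers`). [folklore] -/
instance instDecidableEqCarriersDom : DecidableEq R.carriers.Dom := R.instDecidableEqDom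

variable {R}

/-- THE TAGGED FOOTPRINT of a domain: its cubes of `π_{scale X}`, tagged by the scale. [folklore] -/
def foot (X : R.carriers.Dom) : Finset (Cube R) := X.2.1.map (embC R X.1)

/-- The footprint of an embedded domain. [folklore] -/
theorem foot_embD (j : ℕ) (Y : TDom 4 (R.cubesPerDir j)) : foot (embD R j Y) = Y.1.map (embC R j) := rfl

/-- Membership in the tagged footprint. [folklore] -/
theorem mem_foot {X : R.carriers.Dom} {c : Cube R} : c ∈ foot X ↔ ∃ a ∈ X.2.1, embC R X.1 a = c := Finset.mem_map

/-- A tagged cube of the domain's own scale lies in the footprint iff the cube lies in the domain. [folklore] -/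
@[simp] theorem mk_mem_foot_embD {j : ℕ} {Y : TDom 4 (R.cubesPerDir j)} {a : TPt 4 (R.cubesPerDir j)} :
    (⟨j, a⟩ : Cube R) ∈ foot (embD R j Y) ↔ a ∈ Y.1 :=
  Finset.mem_map' (embC R j)

/-- The tag of a footprint cube is the domain's scale. [folklore] -/
theorem fst_eq_of_mem_foot {X : R.carriers.Dom} {c : Cube R} (h : c ∈ foot X) : c.1 = X.1 := by
  obtain ⟨a, -, rfl⟩ := mem_foot.1 h
  rfl

/-- The footprint has as many tagged cubes as the domain has cubes. [folklore] -/
@[simp] theorem card_foot (X : R.carriers.Dom) : (foot X).card = X.2.1.card := Finset.card_map _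

/-- The footprint is non-empty. [folklore] -/
theorem foot_nonempty (X : R.carriers.Dom) : (foot X).Nonempty := by
  rw [foot, Finset.map_nonempty]
  exact X.2.2.1

/-! ## §2 The touching relation ζ = 0 of (2.11) on tagged cube families -/

variable (R) in
/-- WALL ADJACENCY OF TAGGED CUBES: same scale, and on that scale's torus the two cubes have a common wall (`TreeLengthTorus.TAdj`,
wrap-around walls included) — stated through a Σ-equation so that no cast between the fibres `TPt 4 (R.cubesPerDir j)` is needed;
on a fibre it IS `TAdj` (`cAdj_mk_iff`).  TYPE: [Balaban1988RG2Cluster] (2.11) p. 14. [cite: Balaban1988RG2Cluster, (2.11) p.14] -/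
def CAdj (a b : Cube R) : Prop := ∃ y : TPt 4 (R.cubesPerDir a.1), b = ⟨a.1, y⟩ ∧ TAdj a.2 y

/-- Torus wall adjacency of cube indices is decidable (finite existential over the four directions). [folklore] -/
instance instDecidableTAdj {N : ℕ} : DecidableRel (TAdj (d := 4) (N := N)) := fun a b => by
  unfold TAdj; infer_instance

/-- Tagged wall adjacency is decidable. [folklore] -/
instance instDecidableCAdj : DecidableRel (CAdj R) := fun a b => by
  unfold CAdj; infer_instance

/-- ON A FIBRE, TAGGED ADJACENCY IS THE TORUS WALL ADJACENCY. [folklore] -/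
theorem cAdj_mk_iff {j : ℕ} (x y : TPt 4 (R.cubesPerDir j)) : CAdj R ⟨j, x⟩ ⟨j, y⟩ ↔ TAdj x y := by
  constructor
  · rintro ⟨y', h, hxy⟩
    have hy : y = y' := eq_of_heq (Sigma.mk.inj_iff.1 h).2
    exact hy ▸ hxy
  · exact fun h => ⟨y, rfl, h⟩

/-- Tagged adjacency is symmetric. [folklore] -/
theorem CAdj.symm {a b : Cube R} (h : CAdj R a b) : CAdj R b a := by
  obtain ⟨j, x⟩ := a
  obtain ⟨y, rfl, hxy⟩ := h
  exact ⟨x, rfl, hxy.symm⟩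

/-- Tagged adjacent cubes have the same scale. [folklore] -/
theorem CAdj.fst_eq {a b : Cube R} (h : CAdj R a b) : a.1 = b.1 := by
  obtain ⟨y, rfl, -⟩ := h
  rfl

variable (R) in
/-- TOUCHING TAGGED CUBE FAMILIES — [Balaban1988RG2Cluster] (2.11) p. 14, verbatim: *"ζ(Z, Z′) = 0 if Z ∩ Z′ contains a cube, or a wall
of a cube"*: a common tagged cube, or a tagged cube of one family wall-adjacent (same scale) to a tagged cube of the other.
[cite: Balaban1988RG2Cluster, (2.11) p.14] -/
def touch (A B : Finset (Cube R)) : Prop := ∃ a ∈ A, ∃ b ∈ B, a = b ∨ CAdj R a b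

/-- Touching is decidable. [folklore] -/
instance instDecidableTouch : DecidableRel (touch R) := fun A B => by
  unfold touch; infer_instance

/-- Touching is symmetric. [folklore] -/
theorem touch_symm (A B : Finset (Cube R)) (h : touch R A B) : touch R B A := by
  obtain ⟨a, ha, b, hb, hab⟩ := h
  refine ⟨b, hb, a, ha, ?_⟩
  rcases hab with rfl | hab
  · exact Or.inl rfl
  · exact Or.inr hab.symm

/-- Overlapping families touch. [folklore] -/
theorem touch_of_inter (A B : Finset (Cube R)) (h : (A ∩ B).Nonempty) : touch R A B := by
  obtain ⟨c, hc⟩ := h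
  rw [Finset.mem_inter] at hc
  exact ⟨c, hc.1, c, hc.2, Or.inl rfl⟩

/-- Touching footprints belong to domains of the same scale. [folklore] -/
theorem fst_eq_of_touch_foot {X X' : R.carriers.Dom} (h : touch R (foot X) (foot X')) : X.1 = X'.1 := by
  obtain ⟨a, ha, b, hb, hab⟩ := h
  have h1 : a.1 = X.1 := fst_eq_of_mem_foot ha
  have h2 : b.1 = X'.1 := fst_eq_of_mem_foot hb
  rcases hab with rfl | hab
  · exact h1.symm.trans h2
  · exact h1.symm.trans (hab.fst_eq.trans h2)

/-- **ON THE FOOTPRINTS OF TWO DOMAINS OF ONE SCALE, TOUCHING IS THE TREE's `TTouch`** (share a cube or a torus wall).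
[cite: Balaban1988RG2Cluster, (2.11) p.14] -/
theorem touch_foot_iff {j : ℕ} (Y Y' : TDom 4 (R.cubesPerDir j)) :
    touch R (foot (embD R j Y)) (foot (embD R j Y')) ↔ TTouch Y Y' := by
  constructor
  · rintro ⟨a, ha, b, hb, hab⟩
    obtain ⟨x, hx, rfl⟩ := mem_foot.1 ha
    obtain ⟨y, hy, rfl⟩ := mem_foot.1 hb
    refine ⟨x, hx, y, hy, ?_⟩
    rcases hab with h | h
    · exact Or.inl (eq_of_heq (Sigma.mk.inj_iff.1 h).2)
    · exact Or.inr ((cAdj_mk_iff x y).1 h)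
  · rintro ⟨a, ha, b, hb, hab⟩
    refine ⟨⟨j, a⟩, mk_mem_foot_embD.2 ha, ⟨j, b⟩, mk_mem_foot_embD.2 hb, ?_⟩
    rcases hab with rfl | hab
    · exact Or.inl rfl
    · exact Or.inr ((cAdj_mk_iff a b).2 hab)

/-! ## §3 The `DomainGeometry` of Bałaban's carriers and the reach -/

variable (R) in
/-- **ROUTE P2's L01 GEOMETRY FOR BAŁABAN's CARRIERS OF RECORD**: footprints = tagged cubes, 𝐃_k = `R.domAt k`, touching = (2.11) on
tagged cube families.  `ClusterRepOfDomains.DomainGeometry.clusterRep` ∕ `represents_re` then give route P2's cluster representation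
and its L01 over `R.carriers` BY NAME. [cite: Balaban1988RG2Cluster, (2.11)-(2.13) p.14] -/
def domainGeometry : DomainGeometry R.carriers (Cube R) where
  cubes := foot
  level := R.domAt
  mem_level := fun _ _ => R.mem_domAt
  touch := touch R
  touch_symm := touch_symm
  touch_of_inter := touch_of_inter
  cubes_nonempty := foot_nonempty

/-- The footprints of `domainGeometry` are `foot` (definitional). [folklore] -/
@[simp] theorem domainGeometry_cubes (X : R.carriers.Dom) : (domainGeometry R).cubes X = foot X := rfl

/-- The catalogue of `domainGeometry` is `TwoRuns.domAt` (definitional). [folklore] -/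
@[simp] theorem domainGeometry_level (k : ℕ) : (domainGeometry R).level k = R.domAt k := rfl

/-- The touching relation of `domainGeometry` is `touch` (definitional). [folklore] -/
theorem domainGeometry_touch (A B : Finset (Cube R)) : (domainGeometry R).touch A B = touch R A B := rfl

/-- THE REACH of a domain: the tree's torus reach `treach` (its cubes and their wall-neighbours on the scale's torus), tagged.
[cite: Balaban1988RG2Cluster, (2.11) p.14] -/
def reach (X : R.carriers.Dom) : Finset (Cube R) := (treach X.2).map (embC R X.1)

/-- The reach of an embedded domain. [folklore] -/
theorem reach_embD (j : ℕ) (Y : TDom 4 (R.cubesPerDir j)) : reach (embD R j Y) = (treach Y).map (embC R j) := rfl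

/-- Membership of a same-scale tagged cube in the reach. [folklore] -/
theorem mk_mem_reach_embD {j : ℕ} {Y : TDom 4 (R.cubesPerDir j)} {q : TPt 4 (R.cubesPerDir j)} :
    (⟨j, q⟩ : Cube R) ∈ reach (embD R j Y) ↔ q ∈ treach Y :=
  Finset.mem_map' (embC R j)

/-! ## §4 P2's five combinatorial hypotheses, DISCHARGED on Bałaban's carriers (transfer from `tgeometry 4 N`) -/

/-- `hloc`: touching footprints ⇒ a cube of the other footprint lies in the reach (the tree's `tloc_of_touch`, tagged).
[cite: Balaban1988RG2Cluster, (2.11) p.14] -/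
theorem loc (Z Z' : R.carriers.Dom) (h : touch R (foot Z') (foot Z)) : ∃ q ∈ reach Z, q ∈ foot Z' := by
  obtain ⟨j, Y, rfl⟩ := exists_eq_embD R Z
  obtain ⟨j', Y', rfl⟩ := exists_eq_embD R Z'
  have hjj : j' = j := fst_eq_of_touch_foot h
  subst hjj
  obtain ⟨q, hq, hq'⟩ := tloc_of_touch ((touch_foot_iff Y' Y).1 h)
  exact ⟨⟨j', q⟩, mk_mem_reach_embD.2 hq, mk_mem_foot_embD.2 hq'⟩

/-- `hreach` in d = 4: `#reach Z ≤ 9 · #foot Z` (the tree's `card_treach_le`, 2d + 1 = 9). [folklore] -/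
theorem reach_le (Z : R.carriers.Dom) : ((reach Z).card : ℝ) ≤ 9 * ((foot Z).card : ℝ) := by
  obtain ⟨j, Y, rfl⟩ := exists_eq_embD R Z
  have h := card_treach_le (d := 4) Y
  rw [reach_embD, Finset.card_map, card_foot, snd_embD]
  have h9 : (2 * ((4 : ℕ) : ℝ) + 1) = 9 := by norm_num
  rw [h9] at h
  exact h

/-- `h126`: the (1.26)-SHAPE `Σ_{Y ∈ 𝐃_k, Y ∋ c} e^{−κ₀ d_k(Y)} ≤ K₀` on every fibre `R.domAt k` of Bałaban's carriers, with the tree's torus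
constants κ₀ = κ₀(64, 8) = 64·log 162, K₀ = K₀(64, 8) (d = 4) — transferred from `(tgeometry 4 N).ineq126`.
[cite: Balaban1988RG2Cluster, (1.26) p.8] -/
theorem ineq126_domAt (k : ℕ) :
    Ineq126 (R.domAt k) foot R.carriers.d (B12TreeDecay.kappa₀ (4 * 2 ^ 4) (2 * 4)) (B12TreeDecay.K₀ (4 * 2 ^ 4) (2 * 4)) := by
  classical
  intro c
  obtain ⟨i, a⟩ := c
  by_cases hk : k = i
  · -- the fibre of the cube's own scale: the sum IS the torus sum of `tgeometry 4 N` at the cube `a`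
    subst hk
    have h := (tgeometry 4 (R.cubesPerDir k)).ineq126 a
    rw [domAt_eq_map, Finset.filter_map, Finset.sum_map]
    refine le_trans (le_of_eq (Finset.sum_congr ?_ fun Y _ => rfl)) h
    refine Finset.filter_congr fun Y _ => ?_
    simp only [Function.comp_apply, TreeLengthTorusGeometry.tgeometry_cubes, mk_mem_foot_embD]
  · -- any other fibre: no domain of scale `k` has the scale-`i` cube `⟨i, a⟩` in its footprint
    have hempty : (R.domAt k).filter (fun Y => (⟨i, a⟩ : Cube R) ∈ foot Y) = ∅ := by
      refine Finset.filter_false_of_mem fun Y hY h => hk ?_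
      rw [TwoRuns.mem_domAt] at hY
      have h1 : i = Y.1 := fst_eq_of_mem_foot h
      rw [← hY, h1]
      rfl
    rw [hempty, Finset.sum_empty]
    exact (B12TreeDecay.K₀_pos _ _).le

/-- `hvol`: the (2.30)-SHAPE `#cubes Y ≤ c₁(1 + d_k(Y))`, c₁ = 64 (d = 4), on every fibre `R.domAt k` — transferred from
`(tgeometry 4 N).volBound`. [cite: Balaban1988RG2Cluster, (2.30) p.18] -/
theorem volBound_domAt (k : ℕ) : VolBound (R.domAt k) foot R.carriers.d (4 * 2 ^ 4) := by
  intro X _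
  obtain ⟨j, Y, rfl⟩ := exists_eq_embD R X
  have h := (tgeometry 4 (R.cubesPerDir j)).volBound Y (Finset.mem_univ _)
  rw [card_foot, snd_embD, d_embD]
  exact h

/-- `h227`: (2.27) WITH ITS PRINTED CONSTANT 5 for every domain of Bałaban's carriers and every family of domains of its scale whose
footprints cover its footprint exactly — transferred from `TreeLengthTorusGeometry.ineq227_tcubes` (the torus theorem of unit pv22).
[cite: Balaban1988RG2Cluster, (2.27) p.18] -/
theorem ineq227_dom (X : R.carriers.Dom) :
    Ineq227 (R.domAt (R.carriers.scale X)) foot R.carriers.d (foot X) (R.carriers.d X) 5 := by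
  classical
  obtain ⟨j, Y, rfl⟩ := exists_eq_embD R X
  intro D hD
  rw [mem_coveringFamilies] at hD
  obtain ⟨hsub, hU⟩ := hD
  rw [scale_embD, domAt_eq_map] at hsub
  -- every member of `D` is an embedded domain of scale `j`: pull `D` back along `embD j`
  set D' : Finset (TDom 4 (R.cubesPerDir j)) := Finset.univ.filter fun Y' => embD R j Y' ∈ D with hD'
  have hDmap : D = D'.map (embD R j) := by
    ext Z
    constructor
    · intro hZ
      obtain ⟨Y', -, rfl⟩ := Finset.mem_map.1 (hsub hZ)
      exact Finset.mem_map.2 ⟨Y', by simpa [hD'] using hZ, rfl⟩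
    · intro hZ
      obtain ⟨Y', hY', rfl⟩ := Finset.mem_map.1 hZ
      simpa [hD'] using hY'
  -- the pulled-back family covers `Y` exactly on the scale-`j` torus
  have hU' : D'.biUnion (fun Y' : TDom 4 (R.cubesPerDir j) => Y'.1) = Y.1 := by
    ext a
    have hiff : (⟨j, a⟩ : Cube R) ∈ D.biUnion foot ↔ a ∈ Y.1 := by rw [hU]; exact mk_mem_foot_embD
    rw [← hiff, hDmap, Finset.map_eq_image, Finset.image_biUnion, Finset.mem_biUnion, Finset.mem_biUnion]
    simp only [mk_mem_foot_embD]
  have hmem : D' ∈ coveringFamilies (Finset.univ : Finset (tsys 4 (R.cubesPerDir j)).Dom)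
      (fun Y' : TDom 4 _ => Y'.1) Y.1 :=
    mem_coveringFamilies.2 ⟨Finset.subset_univ _, hU'⟩
  have h := ineq227_tcubes 4 (R.cubesPerDir j) Y D' hmem
  simp only [TreeLengthTorus.tsys_dj] at h
  rw [hDmap, Finset.sum_map, d_embD]
  exact h

/-- THE FIVE HYPOTHESES BUNDLED, in the letters of `ClusterRepDecay.ne5_above_max_of_domainGeometry_linear` (its `hloc`, `hreach`,
`h126`, `hvol`, `h227` at `G := domainGeometry R`, `reach := reach`, `ν = 9`, `κ₀ = κ₀(64,8)`, `K₀ = K₀(64,8)`, `c₁ = 64`, `c = 5`):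
on Bałaban's carriers of record the polymer-geometry side of route P2's END is a THEOREM; what that END still displays are the term
model, the activity majorant, W1, the insertion-data rates, the age budget and the numerical smallness conditions. [folklore] -/
theorem p2_geometry_hypotheses (R : TwoRuns G) :
    let C := R.carriers
    let Γ := domainGeometry R
    (∀ Z Z' : C.Dom, Γ.touch (Γ.cubes Z') (Γ.cubes Z) → ∃ q ∈ reach Z, q ∈ Γ.cubes Z') ∧
    (∀ Z : C.Dom, ((reach Z).card : ℝ) ≤ 9 * (Γ.cubes Z).card) ∧
    (∀ k, Ineq126 (Γ.level k) Γ.cubes C.d (B12TreeDecay.kappa₀ (4 * 2 ^ 4) (2 * 4)) (B12TreeDecay.K₀ (4 * 2 ^ 4) (2 * 4))) ∧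
    (∀ k, VolBound (Γ.level k) Γ.cubes C.d (4 * 2 ^ 4)) ∧
    (∀ X : C.Dom, Ineq227 (Γ.level (C.scale X)) Γ.cubes C.d (Γ.cubes X) (C.d X) 5) :=
  ⟨loc, reach_le, ineq126_domAt, volBound_domAt, ineq227_dom⟩

end Summit.QuantumFields.BalabanUV.T4Continuum.B13DomainGeometry

end
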